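import Summits.AtomisticToContinuum.Crystallization.Theses.FreeSplittingCertificates
import Literature.MathematicalPhysics.StatisticalMechanics.LennardJonesClusters
import Literature.MathematicalPhysics.StatisticalMechanics.LennardJonesThermodynamicLimitProofs

/-!
# Route `FreeSplittingCertificates`, support item `DefectVanishOfStrict`
# (stmt-AtomisticToContinuum-12566)

`StrictSplittingRule → ShellRigidityHcp → ∃ P periodic, DefectVanish(P)`: the glue X₁ → X₂ → hinge
of the route. Along every sequence of Lennard-Jones ground states the fraction of sites whose
`R'`-window is not `ε'`-matched (both ways, up to a linear isometry) to a window of ONE periodic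
configuration `P` tends to `0`.

PROOF (pure counting on top of proved tree facts).
* `δ₀ > 0` from `LennardJonesMinimalDistance_holds`: every Lennard-Jones ground state is
  `δ₀`-separated.
* X₁ (`StrictSplittingRule`) at `δ₀` gives a radius `R`, a rule `Φ` (box + complementarity), a
  spacing `a` and a stretch `t`, with FEASIBILITY (weighted site energy `≥ e_∞` at every site of every
  `δ₀`-separated configuration) and STRICTNESS (`∀ η > 0 ∃ c > 0`, weighted site energy `< e_∞ + c`
  forces the first shell to be `η`-close to `S(a,t)`).
* X₂ (`ShellRigidityHcp`) at `(a,t)` gives the periodic `P`; for `(δ₀, R', ε')` it gives `η > 0` and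
  `L` such that a site all of whose `L`-neighbours have `η`-good shells is matched.
* With `c = c(η)`: an unmatched site `i` has an `L`-neighbour `k` whose shell is not `η`-good, hence
  (strictness, contrapositive) `k` is BAD: slack `≥ c`. Each bad `k` lies within `L` of at most
  `(2L/δ₀ + 1)³` sites (`card_le_of_separated_of_dist_le`), so `#unmatched ≤ (2L/δ₀+1)³ · #bad`.
* Complementarity on realised patterns (`T_ji = T_ij − (x_j − x_i)`) makes the weighted site
  energies sum to the interaction energy `E(N)`; feasibility makes every slack non-negative, so
  `c · #bad ≤ E(N) − N·e_∞ ≤ E(N) − N·e`, where `e = lim E(N)/N ≤ e_∞ = ⨅_M E(M+1)/(M+1)`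
  (`BlancLewin2015_8_holds`). Hence `#unmatched/N ≤ (2L/δ₀+1)³/c · (E(N)/N − e) → 0`.
-/

open scoped BigOperators Topology
open Filter

namespace Summit.AtomisticToContinuum.Crystallization.Theorems

open Literature.MathematicalPhysics.StatisticalMechanics
open Summit.AtomisticToContinuum.Crystallization.Theses.FreeSplittingCertificates

/-- Symmetry of an off-diagonal double sum over a finite index type:
`∑_i ∑_{j ≠ i} g i j = ∑_i ∑_{j ≠ i} g j i`. [folklore] -/
theorem defectVanishOfStrict_sum_erase_comm {N : ℕ} (g : Fin N → Fin N → ℝ) :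
    ∑ i, ∑ j ∈ Finset.univ.erase i, g i j = ∑ i, ∑ j ∈ Finset.univ.erase i, g j i := by
  have h : ∀ f : Fin N → Fin N → ℝ,
      ∑ i, ∑ j ∈ Finset.univ.erase i, f i j = ∑ i, ∑ j, f i j - ∑ i, f i i := by
    intro f
    rw [← Finset.sum_sub_distrib]
    exact Finset.sum_congr rfl fun i _ => Finset.sum_erase_eq_sub (Finset.mem_univ i)
  rw [h, h (fun i j => g j i), Finset.sum_comm]

/-- Splitting every bond's energy between its two ends with complementary weights
(`w i j + w j i = 1`) and summing the weighted site energies returns the interaction energy.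
[folklore] -/
theorem defectVanishOfStrict_sum_weighted_eq {d N : ℕ} (V : ℝ → ℝ)
    (x : Fin N → EuclideanSpace ℝ (Fin d)) (w : Fin N → Fin N → ℝ)
    (hw : ∀ i j, i ≠ j → w i j + w j i = 1) :
    ∑ i, ∑ j ∈ Finset.univ.erase i, w i j * V (dist (x i) (x j)) = interactionEnergy V x := by
  have h2 := two_mul_interactionEnergy V x
  have hsymm := defectVanishOfStrict_sum_erase_comm (fun i j => w i j * V (dist (x i) (x j)))
  have key : ∑ i, ∑ j ∈ Finset.univ.erase i, w i j * V (dist (x i) (x j)) +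
      ∑ i, ∑ j ∈ Finset.univ.erase i, w j i * V (dist (x j) (x i)) = ∑ i, siteEnergy V x i := by
    rw [← Finset.sum_add_distrib]
    refine Finset.sum_congr rfl fun i _ => ?_
    rw [siteEnergy, ← Finset.sum_add_distrib]
    refine Finset.sum_congr rfl fun j hj => ?_
    rw [dist_comm (x j) (x i), ← add_mul, hw i j (Finset.ne_of_mem_erase hj).symm, one_mul]
  linarith

/-- Realised patterns are complementary: the joint `R`-pattern of the bond `(i, j)` recentred at
`x i`, translated by `-(x j - x i)`, is the joint `R`-pattern of the bond `(j, i)` recentred at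
`x j`. [folklore] -/
theorem defectVanishOfStrict_pattern_image {d N : ℕ} (x : Fin N → EuclideanSpace ℝ (Fin d))
    (R : ℝ) (i j : Fin N) :
    (((Finset.univ.filter fun l => dist (x l) (x i) ≤ R ∨ dist (x l) (x j) ≤ R).image
        fun l => x l - x i).image fun u => u - (x j - x i)) =
      (Finset.univ.filter fun l => dist (x l) (x j) ≤ R ∨ dist (x l) (x i) ≤ R).image
        fun l => x l - x j := by
  rw [Finset.image_image,
    Finset.filter_congr (q := fun l => dist (x l) (x j) ≤ R ∨ dist (x l) (x i) ≤ R)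
      fun l _ => or_comm]
  exact Finset.image_congr fun l _ => by simp only [Function.comp_apply, sub_sub_sub_cancel_right]

/-- The bond weights of a complementary rule `Φ` (`Φ v T + Φ (-v) (T - v) = 1` for `v ≠ 0`),
evaluated on the realised patterns of a configuration of distinct points, are complementary.
[folklore] -/
theorem defectVanishOfStrict_weights_compl {d N : ℕ} (x : Fin N → EuclideanSpace ℝ (Fin d))
    (hx : Function.Injective x) (R : ℝ)
    (Φ : EuclideanSpace ℝ (Fin d) → Finset (EuclideanSpace ℝ (Fin d)) → ℝ)
    (hcomp : ∀ v T, v ≠ 0 → Φ v T + Φ (-v) (T.image fun u => u - v) = 1) (i j : Fin N)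
    (hij : i ≠ j) :
    Φ (x j - x i) ((Finset.univ.filter fun l => dist (x l) (x i) ≤ R ∨ dist (x l) (x j) ≤ R).image
        fun l => x l - x i) +
      Φ (x i - x j) ((Finset.univ.filter fun l => dist (x l) (x j) ≤ R ∨ dist (x l) (x i) ≤ R).image
        fun l => x l - x j) = 1 := by
  have h := hcomp (x j - x i)
    ((Finset.univ.filter fun l => dist (x l) (x i) ≤ R ∨ dist (x l) (x j) ≤ R).image
      fun l => x l - x i) (sub_ne_zero.2 (hx.ne hij.symm))
  rwa [neg_sub, defectVanishOfStrict_pattern_image] at h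

/-- Packing: in a `δ`-separated configuration of distinct points of `ℝ³`, the sites within
distance `L` of a given site number at most `(2·max L 0/δ + 1)³`
(`card_le_of_separated_of_dist_le`). [folklore] -/
theorem defectVanishOfStrict_card_near_le {N : ℕ} (x : Fin N → EuclideanSpace ℝ (Fin 3))
    (hx : Function.Injective x) {δ : ℝ} (hδ : 0 < δ)
    (hsep : ∀ i j, i ≠ j → δ ≤ dist (x i) (x j)) (L : ℝ) (k : Fin N) :
    ∃ s : Finset (Fin N), (∀ i, dist (x k) (x i) ≤ L → i ∈ s) ∧
      (s.card : ℝ) ≤ (2 * max L 0 / δ + 1) ^ 3 := by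
  classical
  refine ⟨Finset.univ.filter fun i => dist (x k) (x i) ≤ L, fun i hi => by simp [hi], ?_⟩
  set s := Finset.univ.filter fun i => dist (x k) (x i) ≤ L with hs
  have hcard : (s.image x).card = s.card := Finset.card_image_of_injective _ hx
  have h := card_le_of_separated_of_dist_le (s.image x) (x k) hδ (le_max_right L 0) ?_ ?_
  · rwa [hcard, finrank_euclideanSpace_fin] at h
  · intro c hc
    obtain ⟨i, hi, rfl⟩ := Finset.mem_image.1 hc
    rw [dist_comm]
    exact ((Finset.mem_filter.1 hi).2).trans (le_max_left _ _)
  · intro c hc c' hc' hcc'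
    obtain ⟨i, -, rfl⟩ := Finset.mem_image.1 hc
    obtain ⟨j, -, rfl⟩ := Finset.mem_image.1 hc'
    exact hsep i j fun h => hcc' (congrArg x h)

/-- The counting step, abstractly. Sites carry weighted energies `W k ≥ e` (feasibility) summing to
at most `E`; `W k < e + c` makes the shell of `k` good (strictness); a site all of whose neighbours
have good shells is good (rigidity); every site has at most `K` neighbours. Then the number of bad
sites is at most `K/c · (E − N·e)`. [folklore] -/
theorem defectVanishOfStrict_count {N : ℕ} (W : Fin N → ℝ) (e c E K : ℝ) (hc : 0 < c) (hK : 0 ≤ K)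
    (good shellOK : Fin N → Prop) (near : Fin N → Fin N → Prop)
    (hfeas : ∀ k, e ≤ W k) (hsum : ∑ k, W k ≤ E)
    (hstrict : ∀ k, W k < e + c → shellOK k)
    (hrig : ∀ i, (∀ k, near k i → shellOK k) → good i)
    (hnear : ∀ k, ∃ s : Finset (Fin N), (∀ i, near k i → i ∈ s) ∧ (s.card : ℝ) ≤ K) :
    (Nat.card {i : Fin N // ¬ good i} : ℝ) ≤ K / c * (E - N * e) := by
  classical
  choose s hs hsK using hnear
  set bad : Finset (Fin N) := Finset.univ.filter fun k => e + c ≤ W k with hbad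
  -- Markov: `c · #bad ≤ E − N e`
  have hmarkov : c * (bad.card : ℝ) ≤ E - N * e := by
    calc c * (bad.card : ℝ) = ∑ _k ∈ bad, c := by rw [Finset.sum_const, nsmul_eq_mul, mul_comm]
      _ ≤ ∑ k ∈ bad, (W k - e) :=
          Finset.sum_le_sum fun k hk => by linarith [(Finset.mem_filter.1 hk).2]
      _ ≤ ∑ k, (W k - e) :=
          Finset.sum_le_sum_of_subset_of_nonneg (Finset.subset_univ _)
            fun k _ _ => sub_nonneg.2 (hfeas k)
      _ = ∑ k, W k - N * e := by
          rw [Finset.sum_sub_distrib, Finset.sum_const, Finset.card_univ, Fintype.card_fin,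
            nsmul_eq_mul]
      _ ≤ E - N * e := by linarith
  -- covering: every non-good site has a bad site near it
  have hcover : (Finset.univ.filter fun i => ¬ good i) ⊆ bad.biUnion s := by
    intro i hi
    rw [Finset.mem_filter] at hi
    rw [Finset.mem_biUnion]
    by_contra hcon
    push Not at hcon
    refine hi.2 (hrig i fun k hk => hstrict k (lt_of_not_ge fun hle => ?_))
    exact hcon k (Finset.mem_filter.2 ⟨Finset.mem_univ _, hle⟩) (hs k i hk)
  have hcount : (Nat.card {i : Fin N // ¬ good i} : ℝ) ≤ K * bad.card := by
    rw [Nat.card_eq_fintype_card, Fintype.card_subtype]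
    calc (((Finset.univ.filter fun i => ¬ good i).card : ℕ) : ℝ)
        ≤ ((bad.biUnion s).card : ℝ) := by exact_mod_cast Finset.card_le_card hcover
      _ ≤ ((∑ k ∈ bad, (s k).card : ℕ) : ℝ) := by exact_mod_cast Finset.card_biUnion_le
      _ = ∑ k ∈ bad, ((s k).card : ℝ) := by push_cast; rfl
      _ ≤ ∑ _k ∈ bad, K := Finset.sum_le_sum fun k _ => hsK k
      _ = K * bad.card := by rw [Finset.sum_const, nsmul_eq_mul, mul_comm]
  calc (Nat.card {i : Fin N // ¬ good i} : ℝ) ≤ K * bad.card := hcount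
    _ ≤ K * ((E - N * e) / c) :=
        mul_le_mul_of_nonneg_left ((le_div_iff₀ hc).2 (by linarith)) hK
    _ = K / c * (E - N * e) := by ring

/-- **Item stmt-AtomisticToContinuum-12566 (`DefectVanishOfStrict`, the glue X₁ → X₂ → hinge of
route FreeSplittingCertificates).** A strict finite-range pair-splitting rule for Lennard-Jones
(`StrictSplittingRule`) and the rigidity of its tight shell (`ShellRigidityHcp`) give one
periodic configuration `P` such that, for all `R', ε' > 0`, along every sequence of Lennard-Jones
ground states the fraction of sites whose `R'`-window is not `ε'`-matched to a window of `P` tends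
to `0`. Inputs: `LennardJonesMinimalDistance_holds`, `BlancLewin2015_8_holds`,
`card_le_of_separated_of_dist_le` (all proved in the tree). [route FreeSplittingCertificates,
support item; BlancLewin2015 §2.2–2.3 for context] -/
theorem defectVanishOfStrict_proof : DefectVanishOfStrict := by
  intro h₁ h₂
  obtain ⟨δ₀, hδ₀, hsep⟩ := LennardJonesMinimalDistance_holds
  obtain ⟨R, Φ, a, t, -, ha, ht, ⟨-, hcomp⟩, hfeas, hstrict⟩ := h₁ δ₀ hδ₀
  obtain ⟨P, hP⟩ := h₂ a t ha ht
  refine ⟨P, fun R' ε' hR' hε' x hx => ?_⟩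
  obtain ⟨η, hη, L, hL⟩ := hP δ₀ R' ε' hδ₀ hR' hε'
  obtain ⟨c, hc, hstr⟩ := hstrict η hη
  obtain ⟨e, -, htend, hle⟩ := BlancLewin2015_8_holds 3 (by norm_num) (by norm_num)
  have he : e ≤ ⨅ M : ℕ, groundStateEnergy lennardJones 3 (M + 1) / ((M + 1 : ℕ) : ℝ) :=
    le_ciInf fun M => hle (M + 1) M.succ_pos
  set K : ℝ := (2 * max L 0 / δ₀ + 1) ^ 3 with hK_def
  have hK : 0 ≤ K := by positivity
  have main : ∀ N : ℕ, 0 < N →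
      (Nat.card {i : Fin N // ¬ (∃ q ∈ P.points,
        ∃ A : EuclideanSpace ℝ (Fin 3) →ₗᵢ[ℝ] EuclideanSpace ℝ (Fin 3),
          (∀ p ∈ P.points, dist p q ≤ R' → ∃ j, dist (x N j) (x N i + A (p - q)) ≤ ε') ∧
          (∀ j, dist (x N j) (x N i) ≤ R' → ∃ p ∈ P.points,
            dist (x N j) (x N i + A (p - q)) ≤ ε'))} : ℝ) / N ≤
        K / c * (groundStateEnergy lennardJones 3 N / N - e) := by
    intro N hN
    have hNr : (0 : ℝ) < N := by exact_mod_cast hN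
    have hgs : IsGroundState lennardJones (x N) := hx N
    have hsepN : ∀ i j, i ≠ j → δ₀ ≤ dist (x N i) (x N j) := hsep N (x N) hgs
    have hcnt := defectVanishOfStrict_count _ _ c (groundStateEnergy lennardJones 3 N) K hc hK
      _ _ _ (hfeas N (x N) hsepN)
      (le_of_eq ((defectVanishOfStrict_sum_weighted_eq lennardJones (x N) _
        (defectVanishOfStrict_weights_compl (x N) hgs.1 R Φ hcomp)).trans hgs.2))
      (hstr N (x N) hsepN) (hL N (x N) hsepN)
      (defectVanishOfStrict_card_near_le (x N) hgs.1 hδ₀ hsepN L)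
    calc _ ≤ K / c * (groundStateEnergy lennardJones 3 N - N *
          ⨅ M : ℕ, groundStateEnergy lennardJones 3 (M + 1) / ((M + 1 : ℕ) : ℝ)) / N :=
          div_le_div_of_nonneg_right hcnt hNr.le
      _ ≤ K / c * (groundStateEnergy lennardJones 3 N - N * e) / N := by
          gcongr
      _ = K / c * (groundStateEnergy lennardJones 3 N / N - e) := by
          rw [mul_div_assoc, sub_div, mul_div_cancel_left₀ _ hNr.ne']
  refine squeeze_zero' (Eventually.of_forall fun N => by positivity)
    ((eventually_gt_atTop 0).mono main) ?_
  have hlim := (htend.sub_const e).const_mul (K / c)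
  rwa [sub_self, mul_zero] at hlim

end Summit.AtomisticToContinuum.Crystallization.Theorems
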